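import Summits.AtomisticToContinuum.HydrodynamicLimit.Theorems.OneSphereInfluenceHardCorePoincareDobrushinIdent

/-!
# OneSphereInfluenceHardCorePoincareDobrushinExtension — Abstract Dobrushin theory V: the
bounded-to-`L²` extension [I₂] and [K] proved

This file is part 8/9 of the DobrushinDoor chain proving the crux
`OneSphereInfluence.HardCorePoincare` (stmt-AtomisticToContinuum-13619) sorry-free; the closing
theorem `hardCorePoincare_holds` and the full account are in
`OneSphereInfluenceHardCorePoincareDobrushin.lean` (part 9/9). decomp-a2c · lens-1 · g39.

CONTENTS. Model-free. `L²`-continuity of variance and of `∫ condVar` (`variance_add_le_delta`,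
`integral_condVar_add_le_delta`, `integral_condVar_le_integral_sq`), the truncation argument
`boundedToL2Extension_holds : [I₂]`, and `Abstract.dobrushinGlauberPoincare_holds` (the statement of
[K], expanded).
-/

open MeasureTheory ProbabilityTheory Set Function
open scoped ENNReal

noncomputable section

namespace Summit.AtomisticToContinuum.HydrodynamicLimit.Theorems.HardCorePoincareDobrushin.Abstract

variable {n : ℕ} {E : Type} [MeasurableSpace E]
variable {K : Fin (n + 1) → Kernel (Fin (n + 1) → E) E} [∀ i, IsMarkovKernel (K i)]

/-! ### Proof of `[I₂]`: truncation and `L²`-continuity of variance / conditional variance -/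

section Extension

open Filter Topology

variable {Ω : Type*} {m m₀ : MeasurableSpace Ω} {μ : Measure Ω} [IsProbabilityMeasure μ]

omit [MeasurableSpace E] in
/-- Peter–Paul inequality: `(u + v)² ≤ (1 + δ) u² + (1 + δ⁻¹) v²` for `δ > 0`. -/
theorem sq_add_le_delta (u v : ℝ) {δ : ℝ} (hδ : 0 < δ) :
    (u + v) ^ 2 ≤ (1 + δ) * u ^ 2 + (1 + δ⁻¹) * v ^ 2 := by
  have h := two_mul_le_of_sq (a := u) (b := v) hδ
  nlinarith [h]

/-- `Var(X + Y) ≤ (1+δ) Var X + (1+δ⁻¹) Var Y`. -/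
theorem variance_add_le_delta {X Y : Ω → ℝ} (hX : MemLp X 2 μ) (hY : MemLp Y 2 μ) {δ : ℝ}
    (hδ : 0 < δ) :
    variance (X + Y) μ ≤ (1 + δ) * variance X μ + (1 + δ⁻¹) * variance Y μ := by
  have hXY : MemLp (X + Y) 2 μ := hX.add hY
  rw [variance_eq_integral hXY.aestronglyMeasurable.aemeasurable,
    variance_eq_integral hX.aestronglyMeasurable.aemeasurable,
    variance_eq_integral hY.aestronglyMeasurable.aemeasurable,
    integral_add' (hX.integrable one_le_two) (hY.integrable one_le_two)]
  set a := ∫ ω, X ω ∂μ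
  set b := ∫ ω, Y ω ∂μ
  have iX : Integrable (fun ω => (X ω - a) ^ 2) μ := (hX.sub (memLp_const a)).integrable_sq
  have iY : Integrable (fun ω => (Y ω - b) ^ 2) μ := (hY.sub (memLp_const b)).integrable_sq
  have iXY : Integrable (fun ω => ((X + Y) ω - (a + b)) ^ 2) μ :=
    (hXY.sub (memLp_const (a + b))).integrable_sq
  calc ∫ ω, ((X + Y) ω - (a + b)) ^ 2 ∂μ
      ≤ ∫ ω, ((1 + δ) * (X ω - a) ^ 2 + (1 + δ⁻¹) * (Y ω - b) ^ 2) ∂μ := by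
        refine integral_mono iXY ((iX.const_mul _).add (iY.const_mul _)) fun ω => ?_
        have : (X + Y) ω - (a + b) = (X ω - a) + (Y ω - b) := by simp only [Pi.add_apply]; ring
        rw [this]
        exact sq_add_le_delta _ _ hδ
    _ = (1 + δ) * ∫ ω, (X ω - a) ^ 2 ∂μ + (1 + δ⁻¹) * ∫ ω, (Y ω - b) ^ 2 ∂μ := by
        rw [integral_add (iX.const_mul _) (iY.const_mul _), integral_const_mul, integral_const_mul]

/-- The variance of an `L²` random variable is at most its second moment. -/
theorem variance_le_integral_sq {X : Ω → ℝ} (hX : MemLp X 2 μ) :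
    variance X μ ≤ ∫ ω, (X ω) ^ 2 ∂μ := by
  rw [variance_eq_sub hX]
  have h : 0 ≤ (∫ ω, X ω ∂μ) ^ 2 := sq_nonneg _
  have : (∫ ω, (X ^ 2) ω ∂μ) = ∫ ω, (X ω) ^ 2 ∂μ := rfl
  linarith

/-- The integrated conditional variance equals the mean square of the deviation from the conditional expectation. -/
theorem integral_condVar_eq_integral_sq (hm : m ≤ m₀) {X : Ω → ℝ} (hX : MemLp X 2 μ) :
    ∫ ω, condVar m X μ ω ∂μ = ∫ ω, (X ω - (μ[X | m]) ω) ^ 2 ∂μ := by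
  have hI : Integrable ((X - μ[X | m]) ^ 2) μ := by
    have := (hX.sub (hX.condExp (m := m) one_le_two)).integrable_sq
    exact this
  rw [← setIntegral_univ (f := condVar m X μ), setIntegral_condVar (hm := hm) hI MeasurableSet.univ,
    setIntegral_univ]

/-- The integrated conditional variance is at most the second moment. -/
theorem integral_condVar_le_integral_sq (hm : m ≤ m₀) {X : Ω → ℝ} (hX : MemLp X 2 μ) :
    ∫ ω, condVar m X μ ω ∂μ ≤ ∫ ω, (X ω) ^ 2 ∂μ := by
  calc ∫ ω, condVar m X μ ω ∂μ ≤ ∫ ω, (μ[X ^ 2 | m]) ω ∂μ :=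
        integral_mono_ae integrable_condVar integrable_condExp (condVar_ae_le_condExp_sq hm hX)
    _ = ∫ ω, (X ^ 2) ω ∂μ := integral_condExp hm
    _ = ∫ ω, (X ω) ^ 2 ∂μ := rfl

/-- `∫ Var[X+Y | m] ≤ (1+δ) ∫ Var[X | m] + (1+δ⁻¹) ∫ Var[Y | m]`. -/
theorem integral_condVar_add_le_delta (hm : m ≤ m₀) {X Y : Ω → ℝ} (hX : MemLp X 2 μ)
    (hY : MemLp Y 2 μ) {δ : ℝ} (hδ : 0 < δ) :
    ∫ ω, condVar m (X + Y) μ ω ∂μ ≤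
      (1 + δ) * ∫ ω, condVar m X μ ω ∂μ + (1 + δ⁻¹) * ∫ ω, condVar m Y μ ω ∂μ := by
  have hXY : MemLp (X + Y) 2 μ := hX.add hY
  rw [integral_condVar_eq_integral_sq hm hXY, integral_condVar_eq_integral_sq hm hX,
    integral_condVar_eq_integral_sq hm hY]
  have hadd := condExp_add (hX.integrable one_le_two) (hY.integrable one_le_two) m
  have iX : Integrable (fun ω => (X ω - (μ[X | m]) ω) ^ 2) μ :=
    (hX.sub (hX.condExp one_le_two)).integrable_sq
  have iY : Integrable (fun ω => (Y ω - (μ[Y | m]) ω) ^ 2) μ :=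
    (hY.sub (hY.condExp one_le_two)).integrable_sq
  have iXY : Integrable (fun ω => ((X + Y) ω - (μ[X + Y | m]) ω) ^ 2) μ :=
    (hXY.sub (hXY.condExp one_le_two)).integrable_sq
  calc ∫ ω, ((X + Y) ω - (μ[X + Y | m]) ω) ^ 2 ∂μ
      ≤ ∫ ω, ((1 + δ) * (X ω - (μ[X | m]) ω) ^ 2 + (1 + δ⁻¹) * (Y ω - (μ[Y | m]) ω) ^ 2) ∂μ := by
        refine integral_mono_ae iXY ((iX.const_mul _).add (iY.const_mul _)) ?_
        filter_upwards [hadd] with ω hω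
        have : (X + Y) ω - (μ[X + Y | m]) ω = (X ω - (μ[X | m]) ω) + (Y ω - (μ[Y | m]) ω) := by
          rw [hω]; simp only [Pi.add_apply]; ring
        rw [this]
        exact sq_add_le_delta _ _ hδ
    _ = (1 + δ) * ∫ ω, (X ω - (μ[X | m]) ω) ^ 2 ∂μ +
          (1 + δ⁻¹) * ∫ ω, (Y ω - (μ[Y | m]) ω) ^ 2 ∂μ := by
        rw [integral_add (iX.const_mul _) (iY.const_mul _), integral_const_mul, integral_const_mul]

end Extension

section ExtensionMain

open Filter Topology

/-- **[I₂] PROVED.** -/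
theorem boundedToL2Extension_holds : BoundedToL2Extension := by
  intro n E _ μ _ C hC H f hf
  have H' : ∀ g : (Fin (n + 1) → E) → ℝ, Measurable g → (∃ M : ℝ, ∀ z, |g z| ≤ M) →
      variance g μ ≤ C * ∑ i, ∫ z, condVar (coordSigma n E i) g μ z ∂μ := H
  show variance f μ ≤ C * ∑ i, ∫ z, condVar (coordSigma n E i) f μ z ∂μ
  have hm : ∀ i : Fin (n + 1), coordSigma n E i ≤ (MeasurableSpace.pi : MeasurableSpace (Fin (n + 1) → E)) :=
    fun i => coordSigma_le i
  -- Step 1: reduce to a (strongly) measurable representative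
  suffices key : ∀ f : (Fin (n + 1) → E) → ℝ, Measurable f → MemLp f 2 μ →
      variance f μ ≤ C * ∑ i, ∫ z, condVar (coordSigma n E i) f μ z ∂μ by
    have hff : f =ᵐ[μ] hf.1.mk f := hf.1.ae_eq_mk
    have h1 := key (hf.1.mk f) hf.1.stronglyMeasurable_mk.measurable (hf.ae_eq hff)
    have h2 : ∀ i, ∫ z, condVar (coordSigma n E i) f μ z ∂μ =
        ∫ z, condVar (coordSigma n E i) (hf.1.mk f) μ z ∂μ :=
      fun i => integral_congr_ae (condVar_congr_ae hff)
    rw [variance_congr hff]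
    simp_rw [h2]
    exact h1
  intro f hfm hf
  -- Step 2: the inequality up to a factor `(1+δ)²`, for every `δ > 0`
  have main : ∀ δ : ℝ, 0 < δ →
      variance f μ ≤ (1 + δ) ^ 2 * (C * ∑ i, ∫ z, condVar (coordSigma n E i) f μ z ∂μ) := by
    intro δ hδ
    set S : ℕ → Set (Fin (n + 1) → E) := fun R => {z | (R : ℝ) ≤ ‖f z‖} with hS
    have hSm : ∀ R, MeasurableSet (S R) := fun R => measurableSet_le measurable_const hfm.norm
    have hanti : Antitone S := by
      intro R R' hRR' z hz
      have hz' : (R' : ℝ) ≤ ‖f z‖ := hz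
      show (R : ℝ) ≤ ‖f z‖
      exact le_trans (Nat.cast_le.2 hRR') hz'
    have hinter : (⋂ R, S R) = ∅ := by
      ext z
      simp only [Set.mem_iInter, Set.mem_empty_iff_false, iff_false, not_forall]
      obtain ⟨R, hR⟩ := exists_nat_gt ‖f z‖
      exact ⟨R, not_le.2 hR⟩
    set a : ℕ → ℝ := fun R => ∫ z in S R, (f z) ^ 2 ∂μ with ha
    have ha_tend : Tendsto a atTop (𝓝 0) := by
      have h := tendsto_setIntegral_of_antitone (μ := μ) (f := fun z => (f z) ^ 2) hSm hanti
        ⟨0, hf.integrable_sq.integrableOn⟩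
      rw [hinter, Measure.restrict_empty, integral_zero_measure] at h
      exact h
    have hR : ∀ R : ℕ, variance f μ ≤
        (1 + δ) ^ 2 * (C * ∑ i, ∫ z, condVar (coordSigma n E i) f μ z ∂μ) +
          ((1 + δ) * (1 + δ⁻¹) * C * ((n : ℝ) + 1) + (1 + δ⁻¹)) * a R := by
      intro R
      set b : (Fin (n + 1) → E) → ℝ := (S R).indicator f with hb
      set g : (Fin (n + 1) → E) → ℝ := f - b with hg
      have hbm : Measurable b := hfm.indicator (hSm R)
      have hgm : Measurable g := hfm.sub hbm
      have hbL : MemLp b 2 μ := hf.indicator (hSm R)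
      have hgL : MemLp g 2 μ := hf.sub hbL
      have hgB : ∀ z, |g z| ≤ R := by
        intro z
        rw [hg, Pi.sub_apply, hb]
        by_cases hz : z ∈ S R
        · rw [Set.indicator_of_mem hz, sub_self, abs_zero]; positivity
        · rw [Set.indicator_of_notMem hz, sub_zero]
          have h' : ¬ ((R : ℝ) ≤ ‖f z‖) := hz
          rw [Real.norm_eq_abs] at h'
          exact (not_le.1 h').le
      have hb2 : ∫ z, (b z) ^ 2 ∂μ = a R := by
        rw [ha]; dsimp only
        rw [← integral_indicator (hSm R)]
        congr 1
        funext z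
        rw [hb]
        by_cases hz : z ∈ S R
        · rw [Set.indicator_of_mem hz, Set.indicator_of_mem hz]
        · rw [Set.indicator_of_notMem hz, Set.indicator_of_notMem hz]; ring
      have hHg := H' g hgm ⟨R, hgB⟩
      have hfgb : f = g + b := by rw [hg, sub_add_cancel]
      have hV := variance_add_le_delta hgL hbL hδ
      rw [← hfgb] at hV
      have hVb : variance b μ ≤ a R := (variance_le_integral_sq hbL).trans_eq hb2
      have hgfb : g = f + -b := by rw [hg, sub_eq_add_neg]
      have hE : ∀ i, ∫ z, condVar (coordSigma n E i) g μ z ∂μ ≤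
          (1 + δ) * ∫ z, condVar (coordSigma n E i) f μ z ∂μ + (1 + δ⁻¹) * a R := by
        intro i
        have h1 := integral_condVar_add_le_delta (hm i) hf hbL.neg hδ
        rw [← hgfb] at h1
        have h2 : ∫ z, condVar (coordSigma n E i) (-b) μ z ∂μ ≤ a R := by
          refine (integral_condVar_le_integral_sq (hm i) hbL.neg).trans_eq ?_
          rw [← hb2]
          congr 1
          funext z
          simp only [Pi.neg_apply, neg_sq]
        have h3 : 0 ≤ 1 + δ⁻¹ := by positivity
        have h4 := mul_le_mul_of_nonneg_left h2 h3
        linarith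
      have hsum : ∑ i, ∫ z, condVar (coordSigma n E i) g μ z ∂μ ≤
          (1 + δ) * ∑ i, ∫ z, condVar (coordSigma n E i) f μ z ∂μ +
            ((n : ℝ) + 1) * ((1 + δ⁻¹) * a R) := by
        calc ∑ i, ∫ z, condVar (coordSigma n E i) g μ z ∂μ
            ≤ ∑ i : Fin (n + 1), ((1 + δ) * ∫ z, condVar (coordSigma n E i) f μ z ∂μ + (1 + δ⁻¹) * a R) :=
              Finset.sum_le_sum fun i _ => hE i
          _ = _ := by
              rw [Finset.sum_add_distrib, ← Finset.mul_sum, Finset.sum_const, Finset.card_univ,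
                Fintype.card_fin, nsmul_eq_mul]
              push_cast; ring
      have hδ1 : 0 ≤ 1 + δ := by positivity
      have hδ2 : 0 ≤ 1 + δ⁻¹ := by positivity
      have step1 : variance f μ ≤ (1 + δ) * (C * ∑ i, ∫ z, condVar (coordSigma n E i) g μ z ∂μ) +
          (1 + δ⁻¹) * a R :=
        hV.trans (add_le_add (mul_le_mul_of_nonneg_left hHg hδ1)
          (mul_le_mul_of_nonneg_left hVb hδ2))
      have step2 : C * ∑ i, ∫ z, condVar (coordSigma n E i) g μ z ∂μ ≤
          C * ((1 + δ) * ∑ i, ∫ z, condVar (coordSigma n E i) f μ z ∂μ +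
            ((n : ℝ) + 1) * ((1 + δ⁻¹) * a R)) := mul_le_mul_of_nonneg_left hsum hC
      have step3 := mul_le_mul_of_nonneg_left step2 hδ1
      calc variance f μ ≤ (1 + δ) * (C * ∑ i, ∫ z, condVar (coordSigma n E i) g μ z ∂μ) +
            (1 + δ⁻¹) * a R := step1
        _ ≤ (1 + δ) * (C * ((1 + δ) * ∑ i, ∫ z, condVar (coordSigma n E i) f μ z ∂μ +
            ((n : ℝ) + 1) * ((1 + δ⁻¹) * a R))) + (1 + δ⁻¹) * a R := add_le_add step3 le_rfl
        _ = _ := by ring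
    have hlim : Tendsto (fun R : ℕ =>
        (1 + δ) ^ 2 * (C * ∑ i, ∫ z, condVar (coordSigma n E i) f μ z ∂μ) +
          ((1 + δ) * (1 + δ⁻¹) * C * ((n : ℝ) + 1) + (1 + δ⁻¹)) * a R) atTop
        (𝓝 ((1 + δ) ^ 2 * (C * ∑ i, ∫ z, condVar (coordSigma n E i) f μ z ∂μ) +
          ((1 + δ) * (1 + δ⁻¹) * C * ((n : ℝ) + 1) + (1 + δ⁻¹)) * 0)) :=
      tendsto_const_nhds.add (ha_tend.const_mul _)
    rw [mul_zero, add_zero] at hlim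
    exact ge_of_tendsto hlim (Filter.Eventually.of_forall hR)
  -- Step 3: `δ → 0⁺`
  set B : ℝ := C * ∑ i, ∫ z, condVar (coordSigma n E i) f μ z ∂μ with hB
  have hcont : Tendsto (fun δ : ℝ => (1 + δ) ^ 2 * B) (𝓝[>] 0) (𝓝 ((1 + 0) ^ 2 * B)) :=
    tendsto_nhdsWithin_of_tendsto_nhds
      ((((continuous_const.add continuous_id).pow 2).mul continuous_const).tendsto 0)
  rw [add_zero, one_pow, one_mul] at hcont
  exact ge_of_tendsto hcont (eventually_nhdsWithin_of_forall fun δ hδ => main δ hδ)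

end ExtensionMain

/-- **[K] PROVED**: the Dobrushin–Glauber Poincaré inequality (statement of the node's `[K]`,
expanded verbatim). -/
theorem dobrushinGlauberPoincare_holds :
    ∀ (n : ℕ) (E : Type) [MeasurableSpace E]
    (μ : Measure (Fin (n + 1) → E)) [IsProbabilityMeasure μ]
    (K : Fin (n + 1) → Kernel (Fin (n + 1) → E) E) [∀ i, IsMarkovKernel (K i)]
    (c : Fin (n + 1) → Fin (n + 1) → ℝ) (D : ℝ),
    (∀ i (z : Fin (n + 1) → E) (y : E), K i (Function.update z i y) = K i z) →
    (∀ i (f : (Fin (n + 1) → E) → ℝ≥0∞), Measurable f →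
        ∫⁻ z, ∫⁻ y, f (Function.update z i y) ∂(K i z) ∂μ = ∫⁻ z, f z ∂μ) →
    (∀ i j, 0 ≤ c i j) →
    (∀ i j (z : Fin (n + 1) → E) (y : E) (A : Set E), MeasurableSet A →
        ((K i z) A).toReal ≤ ((K i (Function.update z j y)) A).toReal + c i j) →
    (∀ i, ∑ j, c i j ≤ D) → (∀ j, ∑ i, c i j ≤ D) → D < 1 →
    ∀ f : (Fin (n + 1) → E) → ℝ, MemLp f 2 μ →
      variance f μ ≤ (1 - D)⁻¹ * ∑ i : Fin (n + 1), ∫ z, condVar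
        (MeasurableSpace.comap (fun (z : Fin (n + 1) → E) (j : Fin n) => z (i.succAbove j))
          MeasurableSpace.pi) f μ z ∂μ :=
  dobrushinGlauberPoincare_of_extension boundedToL2Extension_holds

end Summit.AtomisticToContinuum.HydrodynamicLimit.Theorems.HardCorePoincareDobrushin.Abstract

end
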